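import Summits.NavierStokesRegularity.NavierStokesRegularity.Theorems.PoloidalWindowDoorPoloidalWindowRigidityZShockCompactDisturbance
import Summits.NavierStokesRegularity.NavierStokesRegularity.Theorems.PoloidalWindowDoorPoloidalWindowRigidityZShockQuietTools
import HarnessLib

/-!
# Crux K2 `PoloidalWindowRigidity` (stmt-NavierStokesRegularity-19708), line `z_shock` — ★ RUNG R2 WITHOUT ANY SIGN HYPOTHESIS WHEN
# ONE RIEMANN INVARIANT IS QUIET AT SPATIAL INFINITY ON ONE SLICE

`--supports stmt-NavierStokesRegularity-19708 --as helper` (leafhand-ns-poloidalwindowdoor-3 g3, cell decomp-ns, 2026-08-31).  Class-free,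
Mathlib + tree files only.  **No stub and no summit is closed by this file; Navier–Stokes regularity is NOT proved here (rung 0).**

`pSystem_const_of_quiet_backward_invariant` — let `(w, p) ∈ C²` solve the autonomous p-system `p_z = −κ(w)² w_x`, `w_z = −p_x` on
`ℝ × ℝ` (two-sided in the height `z`), with `0 < κlo ≤ κ(w) ≤ κhi`, `|κ'(w)| ≤ k₁`, `|w| ≤ Mw`, `|w_x| ≤ W₁` along the solution,
`κ > 0`, `κ ∈ C¹` NOWHERE LINEARLY DEGENERATE — and NO hypothesis on the sign of `κ'`.  If on the slice `z = 0` the backward Riemann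
invariant `s = p − K(w)` (`K' = κ`) has the SAME limit `sbar` as `x → +∞` and as `x → −∞` (the forward invariant `r = p + K(w)` is
arbitrary), then `(w, p)` is constant.  This contains `…ZShockCompactDisturbance` (p823563: constant state outside `|x| ≤ R`) and
`…ZShockScalarEternal.pSystem_const_of_backward_flat` (p823407: `s` constant); `pSystem_const_of_quiet_forward_invariant` is the
twin with the roles of `r` and `s` exchanged (reflection `x ↦ −x, p ↦ −p`).  RESIDUAL of the census item «R2 with sign-changing `κ'`» after this file: solutions BOTH of
whose Riemann invariants fail to settle (to one two-sided limit) at spatial infinity on every slice — persistent two-family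
interaction (Klainerman–Majda's periodic theorem is the forward-in-time model).

Proof.  (1) Domain of dependence: `s(z, x) = s(0, y)` with `y ≥ x + κlo z` (`z ≥ 0`) / `y ≤ x + κlo z` (`z ≤ 0`).  (2) Along the
forward characteristic `X` from `(0, x₀)` (`X z ≷ x₀ + κlo z`): `s ∘ X → sbar` at BOTH ends, so `K(w ∘ X) → L = (r(0,x₀) − sbar)/2`
and `w ∘ X → v` with `K(v) = L` at both ends (`…QuietTools.exists_lim_of_tendsto_strictMono`).  (3) John's weighted gradient
`q = e^{h} r_x`, `h = ½ log κ(w ∘ X)`, solves `q' = −G(w ∘ X) q²` with `G(u) = κ'(u) e^{−½ log κ(u)}/(2κ(u))` EXACTLY (Lax's identity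
`(r_x)' = −κ'(w) w_x r_x` plus `w_z − κ w_x = −r_x`); `r_x` never vanishes along `X` if `r_x(0, x₀) ≠ 0` (linear equation), so `q`
never vanishes; `G(w ∘ X) → G(v)` at both ends; if `κ'(v) ≠ 0` then `G` has a fixed sign near both ends and
`…QuietTools.riccati_no_twoSided_of_eventually_pos/neg` gives a contradiction.  So `κ'(v) = 0`.  (4) Interval filling exactly as in
p823563: `r_x(0, ·) ≡ 0`, `r` constant on `ℝ × ℝ`, forward-flat, `…ScalarEternal.pSystem_const_of_forward_flat`. [folklore]
(Lax 1964; John 1974; Klainerman–Majda 1980)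
-/

noncomputable section

namespace Summit.NavierStokesRegularity.NavierStokesRegularity.Theorems.PoloidalWindowDoorPoloidalWindowRigidityZShockQuietInvariant

-- the summit and its single sub-problem share the name (CONVENTIONS §1)
set_option linter.dupNamespace false

open Set Filter Topology Function Metric
open Summit.NavierStokesRegularity.NavierStokesRegularity.Theorems.PoloidalWindowDoorPoloidalWindowRigidityZShockCharacteristicRiccati
open Summit.NavierStokesRegularity.NavierStokesRegularity.Theorems.PoloidalWindowDoorPoloidalWindowRigidityZShockPSystemLiouville
open Summit.NavierStokesRegularity.NavierStokesRegularity.Theorems.PoloidalWindowDoorPoloidalWindowRigidityZShockPSystemNonuniform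
open Summit.NavierStokesRegularity.NavierStokesRegularity.Theorems.PoloidalWindowDoorPoloidalWindowRigidityZShockScalarEternal
open Summit.NavierStokesRegularity.NavierStokesRegularity.Theorems.PoloidalWindowDoorPoloidalWindowRigidityZShockCompactDisturbance
open Summit.NavierStokesRegularity.NavierStokesRegularity.Theorems.PoloidalWindowDoorPoloidalWindowRigidityZShockQuietTools

variable {w p : ℝ × ℝ → ℝ} {κ κ' K : ℝ → ℝ} {κlo κhi k₁ W₁ Mw sbar : ℝ}

/-- **★ R2 without sign hypothesis when the backward invariant is quiet at spatial infinity** (hypotheses and proof in the module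
docstring). [folklore] -/
theorem pSystem_const_of_quiet_backward_invariant (hw : ContDiff ℝ 2 w) (hp : ContDiff ℝ 2 p)
    (hK2 : ContDiff ℝ 2 K) (hKd : ∀ v, HasDerivAt K (κ v) v) (hκd : ∀ v, HasDerivAt κ (κ' v) v) (hκ'c : Continuous κ')
    (hsys1 : ∀ q, fderiv ℝ p q (1, 0) = -(κ (w q) ^ 2 * fderiv ℝ w q (0, 1)))
    (hsys2 : ∀ q, fderiv ℝ w q (1, 0) = -fderiv ℝ p q (0, 1))
    (hκlo0 : 0 < κlo) (hκlo : ∀ q, κlo ≤ κ (w q)) (hκhi : ∀ q, κ (w q) ≤ κhi)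
    (hκpos : ∀ v, 0 < κ v) (hgn : ∀ a b : ℝ, a < b → ∃ v ∈ Ioo a b, κ' v ≠ 0)
    (hk₁ : ∀ q, |κ' (w q)| ≤ k₁) (hW₁ : ∀ q, |fderiv ℝ w q (0, 1)| ≤ W₁) (hMw : ∀ q, |w q| ≤ Mw)
    (hquietTop : Tendsto (fun x : ℝ => p (0, x) - K (w (0, x))) atTop (𝓝 sbar))
    (hquietBot : Tendsto (fun x : ℝ => p (0, x) - K (w (0, x))) atBot (𝓝 sbar)) :
    ∀ q q' : ℝ × ℝ, w q = w q' ∧ p q = p q' := by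
  have hw1 : Differentiable ℝ w := hw.differentiable (by simp)
  have hp1 : Differentiable ℝ p := hp.differentiable (by simp)
  have hKc : Continuous K := hK2.continuous
  have hκc : Continuous κ := continuous_iff_continuousAt.2 fun v => (hκd v).continuousAt
  have hKmono : StrictMono K := strictMono_of_deriv_pos fun v => by rw [(hKd v).deriv]; exact hκpos v
  have hκB : ∀ q, |κ (w q)| ≤ κhi := fun q => by rw [abs_of_pos (hκpos _)]; exact hκhi q
  -- Riemann invariants
  set r : ℝ × ℝ → ℝ := fun q => p q + K (w q) with hrdef
  set s : ℝ × ℝ → ℝ := fun q => p q - K (w q) with hsdef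
  have hr2 : ContDiff ℝ 2 r := hp.add (hK2.comp hw)
  have hr1 : Differentiable ℝ r := hr2.differentiable (by simp)
  have hKw : ∀ q, HasFDerivAt (fun q' => K (w q')) (κ (w q) • fderiv ℝ w q) q :=
    fun q => (hKd (w q)).comp_hasFDerivAt q (hw1 q).hasFDerivAt
  have hrF : ∀ q, HasFDerivAt r (fderiv ℝ p q + κ (w q) • fderiv ℝ w q) q :=
    fun q => (hp1 q).hasFDerivAt.add (hKw q)
  have hsF : ∀ q, HasFDerivAt s (fderiv ℝ p q - κ (w q) • fderiv ℝ w q) q :=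
    fun q => (hp1 q).hasFDerivAt.sub (hKw q)
  have hs1 : Differentiable ℝ s := fun q => (hsF q).differentiableAt
  have hrD : ∀ q v, fderiv ℝ r q v = fderiv ℝ p q v + κ (w q) * fderiv ℝ w q v := by
    intro q v; rw [(hrF q).fderiv]; simp [smul_eq_mul]
  have hsD : ∀ q v, fderiv ℝ s q v = fderiv ℝ p q v - κ (w q) * fderiv ℝ w q v := by
    intro q v; rw [(hsF q).fderiv]; simp [smul_eq_mul]
  -- the forward speed field and the two diagonal equations
  set c₁ : ℝ × ℝ → ℝ := fun q => κ (w q) with hc₁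
  have hκw : ∀ q, HasFDerivAt (fun q' => κ (w q')) (κ' (w q) • fderiv ℝ w q) q :=
    fun q => (hκd (w q)).comp_hasFDerivAt q (hw1 q).hasFDerivAt
  have hc₁d : Differentiable ℝ c₁ := fun q => (hκw q).differentiableAt
  have hc₁x : ∀ q, fderiv ℝ c₁ q (0, 1) = κ' (w q) * fderiv ℝ w q (0, 1) := by
    intro q; rw [hc₁, (hκw q).fderiv]; simp [smul_eq_mul]
  have hPDE1 : ∀ q, fderiv ℝ r q (1, 0) + c₁ q * fderiv ℝ r q (0, 1) = 0 := by
    intro q; rw [hrD, hrD, hc₁, hsys1, hsys2]; ring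
  have hPDE2 : ∀ q, fderiv ℝ s q (1, 0) + (fun q => -κ (w q)) q * fderiv ℝ s q (0, 1) = 0 := by
    intro q; simp only; rw [hsD, hsD, hsys1, hsys2]; ring
  -- global characteristics of both families
  have hκd' : ∀ v, HasDerivAt (fun v => -κ v) ((fun v => -κ' v) v) v := fun v => (hκd v).neg
  have hκB' : ∀ q, |(fun v => -κ v) (w q)| ≤ κhi := fun q => by simp only [abs_neg]; exact hκB q
  have hk₁' : ∀ q, |(fun v => -κ' v) (w q)| ≤ k₁ := fun q => by simp only [abs_neg]; exact hk₁ q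
  have hfwd : ∀ z₀ x₀ : ℝ, ∃ X : ℝ → ℝ, X z₀ = x₀ ∧ ∀ z, HasDerivAt X (κ (w (z, X z))) z :=
    fun z₀ x₀ => exists_global_char hw1 hκd hκB hk₁ hW₁ z₀ x₀
  have hbwd : ∀ z₀ x₀ : ℝ, ∃ Y : ℝ → ℝ, Y z₀ = x₀ ∧ ∀ z, HasDerivAt Y (-κ (w (z, Y z))) z :=
    fun z₀ x₀ => exists_global_char (c := fun v => -κ v) hw1 hκd' hκB' hk₁' hW₁ z₀ x₀
  -- (1) DOMAIN OF DEPENDENCE for `s`, pointwise form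
  have hsA : ∀ z x : ℝ, ∃ y : ℝ, s (z, x) = s (0, y) ∧ (0 ≤ z → x + κlo * z ≤ y) ∧ (z ≤ 0 → y ≤ x + κlo * z) := by
    intro z x
    obtain ⟨Y, hY0, hY⟩ := hbwd z x
    have hYd : Differentiable ℝ Y := fun t => (hY t).differentiableAt
    have hYle : ∀ t, deriv Y t ≤ -κlo := fun t => by rw [(hY t).deriv]; linarith [hκlo (t, Y t)]
    refine ⟨Y 0, ?_, fun hz => ?_, fun hz => ?_⟩
    · have h := const_along (c := fun q => -κ (w q)) hs1 hPDE2 hY z 0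
      rwa [hY0] at h
    · have h := image_sub_le_mul_sub_of_deriv_le hYd hYle hz
      rw [hY0] at h; nlinarith
    · have h := image_sub_le_mul_sub_of_deriv_le hYd hYle hz
      rw [hY0] at h; nlinarith
  choose y hy using hsA
  -- (2)+(3) along a forward characteristic from `(0, x₀)` with `r_x(0, x₀) ≠ 0`, the limiting value `v` is degenerate
  have hC : ∀ x₀ : ℝ, fderiv ℝ r (0, x₀) (0, 1) ≠ 0 → ∃ v : ℝ, K v = (r (0, x₀) - sbar) / 2 ∧ κ' v = 0 := by
    intro x₀ hα0
    obtain ⟨X, hX0, hX⟩ := hfwd 0 x₀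
    have hXd : Differentiable ℝ X := fun t => (hX t).differentiableAt
    have hXge : ∀ t, κlo ≤ deriv X t := fun t => by rw [(hX t).deriv]; exact hκlo (t, X t)
    have hrX : ∀ z, r (z, X z) = r (0, x₀) := fun z => by
      have h := const_along (c := c₁) hr1 hPDE1 hX z 0
      rwa [hX0] at h
    have hXfwd : ∀ z, 0 ≤ z → x₀ + κlo * z ≤ X z := fun z hz => by
      have h := mul_sub_le_image_sub_of_le_deriv hXd hXge hz
      rw [hX0] at h; linarith
    have hXbwd : ∀ z, z ≤ 0 → X z ≤ x₀ + κlo * z := fun z hz => by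
      have h := mul_sub_le_image_sub_of_le_deriv hXd hXge hz
      rw [hX0] at h; linarith
    -- the foot `y z (X z)` of the backward characteristic escapes to `±∞`
    have hytop : Tendsto (fun z => y z (X z)) atTop atTop := by
      refine tendsto_atTop_atTop.2 fun b => ⟨max 0 ((b - x₀) / (2 * κlo)), fun z hz => ?_⟩
      have hz0 : 0 ≤ z := le_trans (le_max_left _ _) hz
      have hz1 : (b - x₀) / (2 * κlo) ≤ z := le_trans (le_max_right _ _) hz
      rw [div_le_iff₀ (by positivity)] at hz1
      linarith [(hy z (X z)).2.1 hz0, hXfwd z hz0]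
    have hybot : Tendsto (fun z => y z (X z)) atBot atBot := by
      refine tendsto_atBot_atBot.2 fun b => ⟨min 0 ((b - x₀) / (2 * κlo)), fun z hz => ?_⟩
      have hz0 : z ≤ 0 := le_trans hz (min_le_left _ _)
      have hz1 : z ≤ (b - x₀) / (2 * κlo) := le_trans hz (min_le_right _ _)
      rw [le_div_iff₀ (by positivity)] at hz1
      linarith [(hy z (X z)).2.2 hz0, hXbwd z hz0]
    have hsXtop : Tendsto (fun z => s (z, X z)) atTop (𝓝 sbar) := by
      refine Tendsto.congr (fun z => ?_) (hquietTop.comp hytop)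
      exact ((hy z (X z)).1).symm
    have hsXbot : Tendsto (fun z => s (z, X z)) atBot (𝓝 sbar) := by
      refine Tendsto.congr (fun z => ?_) (hquietBot.comp hybot)
      exact ((hy z (X z)).1).symm
    -- `K (w ∘ X) → L` at both ends, hence `w ∘ X → v` with `K v = L`
    set L : ℝ := (r (0, x₀) - sbar) / 2 with hL
    have hKwX : ∀ z, K (w (z, X z)) = (r (0, x₀) - s (z, X z)) / 2 := fun z => by
      have h := hrX z
      simp only [hrdef, hsdef] at h ⊢
      linarith
    have hKXtop : Tendsto (fun z => K (w (z, X z))) atTop (𝓝 L) := by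
      have h := (tendsto_const_nhds (x := r (0, x₀)).sub hsXtop).div_const 2
      exact h.congr fun z => (hKwX z).symm
    have hKXbot : Tendsto (fun z => K (w (z, X z))) atBot (𝓝 L) := by
      have h := (tendsto_const_nhds (x := r (0, x₀)).sub hsXbot).div_const 2
      exact h.congr fun z => (hKwX z).symm
    obtain ⟨v, hKv, hwXtop⟩ :=
      exists_lim_of_tendsto_strictMono (f := fun z => w (z, X z)) hKc hKmono (fun z => hMw (z, X z)) hKXtop
    obtain ⟨v', hKv', hwXbot⟩ :=
      exists_lim_of_tendsto_strictMono (f := fun z => w (z, X z)) hKc hKmono (fun z => hMw (z, X z)) hKXbot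
    have hvv : v' = v := hKmono.injective (by rw [hKv, hKv'])
    rw [hvv] at hwXbot
    -- Lax's identity along `X`: `α' = −κ'(w) w_x α`; `α` never vanishes
    set α : ℝ → ℝ := fun t => fderiv ℝ r (t, X t) (0, 1) with hαdef
    have hLax : ∀ z, HasDerivAt α (-(κ' (w (z, X z)) * fderiv ℝ w (z, X z) (0, 1)) * α z) z := by
      intro z
      have h := transversal_deriv_along_of_speed hr2 hc₁d hPDE1 hX z
      rw [hc₁x] at h
      refine h.congr_deriv ?_
      simp only [hαdef]; ring
    have hαne : ∀ z, α z ≠ 0 := by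
      refine ne_zero_of_linear (G := k₁ * W₁) (z₀ := 0) hLax (fun z => ?_) (by simpa [hαdef, hX0] using hα0)
      rw [abs_neg, abs_mul]
      exact mul_le_mul (hk₁ _) (hW₁ _) (abs_nonneg _) ((abs_nonneg _).trans (hk₁ (z, X z)))
    -- John's weight `h = ½ log κ(w ∘ X)` and the weighted gradient `q = e^h α`
    have hφd : ∀ z, HasDerivAt (fun t => w (t, X t))
        (fderiv ℝ w (z, X z) (1, 0) + κ (w (z, X z)) * fderiv ℝ w (z, X z) (0, 1)) z :=
      fun z => hasDerivAt_along (hw1 (z, X z)) (hX z)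
    set G : ℝ → ℝ := fun u => κ' u / (2 * κ u) * Real.exp (-(Real.log (κ u) / 2)) with hG
    set qJ : ℝ → ℝ := fun t => Real.exp (Real.log (κ (w (t, X t))) / 2) * α t with hqJ
    have hq : ∀ z, HasDerivAt qJ (-(G (w (z, X z)) * qJ z ^ 2)) z := by
      intro z
      have hκz : κ (w (z, X z)) ≠ 0 := (hκpos _).ne'
      have h1 : HasDerivAt (fun t => κ (w (t, X t)))
          (κ' (w (z, X z)) * (fderiv ℝ w (z, X z) (1, 0) + κ (w (z, X z)) * fderiv ℝ w (z, X z) (0, 1))) z :=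
        (hκd (w (z, X z))).comp z (hφd z)
      have h2 := ((h1.log hκz).div_const 2).exp
      have h3 := h2.mul (hLax z)
      refine h3.congr_deriv ?_
      have hwz : fderiv ℝ w (z, X z) (1, 0) = -fderiv ℝ p (z, X z) (0, 1) := hsys2 _
      have hαz : α z = fderiv ℝ p (z, X z) (0, 1) + κ (w (z, X z)) * fderiv ℝ w (z, X z) (0, 1) := hrD _ _
      simp only [hqJ, hG]
      rw [hαz, hwz, Real.exp_neg]
      field_simp
      ring
    have hqne : ∀ z, qJ z ≠ 0 := fun z => mul_ne_zero (Real.exp_pos _).ne' (hαne z)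
    -- `G (w ∘ X) → G v` at both ends
    have hGc : ContinuousAt G v := by
      have hκv : κ v ≠ 0 := (hκpos v).ne'
      refine ContinuousAt.mul ?_ ?_
      · exact hκ'c.continuousAt.div (continuousAt_const.mul hκc.continuousAt) (mul_ne_zero two_ne_zero hκv)
      · exact ((hκc.continuousAt.log hκv).div_const 2).neg.rexp
    have hGtop : Tendsto (fun z => G (w (z, X z))) atTop (𝓝 (G v)) := hGc.tendsto.comp hwXtop
    have hGbot : Tendsto (fun z => G (w (z, X z))) atBot (𝓝 (G v)) := hGc.tendsto.comp hwXbot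
    -- conclusion: `κ' v = 0`
    refine ⟨v, hKv, ?_⟩
    by_contra hκ'v
    have hGv : G v ≠ 0 := by
      simp only [hG]
      exact mul_ne_zero (div_ne_zero hκ'v (mul_ne_zero two_ne_zero (hκpos v).ne')) (Real.exp_pos _).ne'
    rcases lt_or_gt_of_ne hGv with hneg | hpos
    · have hlt : G v < G v / 2 := by linarith
      obtain ⟨T, hT⟩ := eventually_atTop.1 (hGtop.eventually_lt_const hlt)
      obtain ⟨S, hS⟩ := eventually_atBot.1 (hGbot.eventually_lt_const hlt)
      exact riccati_no_twoSided_of_eventually_neg (b₀ := -(G v / 2)) hq hqne (by linarith)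
        (fun z hz => by linarith [hT z hz]) (fun z hz => by linarith [hS z hz])
    · have hlt : G v / 2 < G v := by linarith
      obtain ⟨T, hT⟩ := eventually_atTop.1 (hGtop.eventually_const_lt hlt)
      obtain ⟨S, hS⟩ := eventually_atBot.1 (hGbot.eventually_const_lt hlt)
      exact riccati_no_twoSided_of_eventually_pos (b₀ := G v / 2) hq hqne (by linarith)
        (fun z hz => (hT z hz).le) (fun z hz => (hS z hz).le)
  -- (4) `r_x(0, ·) ≡ 0` by interval filling
  have hρd : ∀ x, HasDerivAt (fun y : ℝ => r (0, y)) (fderiv ℝ r (0, x) ((0 : ℝ), (1 : ℝ))) x := fun x =>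
    (hr1 (0, x)).hasFDerivAt.comp_hasDerivAt x ((hasDerivAt_const x (0 : ℝ)).prodMk (hasDerivAt_id x))
  have hρc : Continuous fun y : ℝ => r (0, y) := hr1.continuous.comp (continuous_const.prodMk continuous_id)
  have hρ'c : Continuous fun x : ℝ => fderiv ℝ r (0, x) (0, 1) :=
    ((hr2.continuous_fderiv (by simp)).comp (continuous_const.prodMk continuous_id)).clm_apply continuous_const
  have hD : ∀ x, fderiv ℝ r (0, x) (0, 1) = 0 := by
    intro x₁
    by_contra hne
    obtain ⟨δ, hδ, hball⟩ : ∃ δ > 0, ∀ x, dist x x₁ < δ → fderiv ℝ r (0, x) (0, 1) ≠ 0 := by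
      have hev := (hρ'c.continuousAt (x := x₁)).eventually_ne hne
      obtain ⟨δ, hδ, h⟩ := Metric.eventually_nhds_iff.1 hev
      exact ⟨δ, hδ, fun x hx => h hx⟩
    have hlt : x₁ < x₁ + δ / 2 := by linarith
    obtain ⟨η, hη, hηd⟩ := exists_hasDerivAt_eq_slope (fun y : ℝ => r (0, y)) (fun x => fderiv ℝ r (0, x) (0, 1))
      hlt hρc.continuousOn (fun x _ => hρd x)
    have hIcc_ball : ∀ x ∈ Icc x₁ (x₁ + δ / 2), dist x x₁ < δ := fun x hx => by
      rw [Real.dist_eq, abs_lt]; constructor <;> linarith [hx.1, hx.2]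
    have hneq : r (0, x₁) ≠ r (0, x₁ + δ / 2) := by
      intro heq
      have : fderiv ℝ r (0, η) (0, 1) = 0 := by rw [hηd, heq, sub_self, zero_div]
      exact hball η (hIcc_ball η (Ioo_subset_Icc_self hη)) this
    obtain ⟨xa, xb, hxa, hxb, hab⟩ : ∃ xa xb : ℝ, xa ∈ Icc x₁ (x₁ + δ / 2) ∧ xb ∈ Icc x₁ (x₁ + δ / 2) ∧
        r (0, xa) < r (0, xb) := by
      rcases lt_or_gt_of_ne hneq with h | h
      · exact ⟨x₁, x₁ + δ / 2, left_mem_Icc.2 hlt.le, right_mem_Icc.2 hlt.le, h⟩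
      · exact ⟨x₁ + δ / 2, x₁, right_mem_Icc.2 hlt.le, left_mem_Icc.2 hlt.le, h⟩
    obtain ⟨va, hKva, -⟩ := hC xa (hball xa (hIcc_ball xa hxa))
    obtain ⟨vb, hKvb, -⟩ := hC xb (hball xb (hIcc_ball xb hxb))
    have hvab : va < vb := hKmono.lt_iff_lt.1 (by rw [hKva, hKvb]; linarith)
    obtain ⟨v, hv, hv'⟩ := hgn va vb hvab
    have hKv1 : K va < K v := hKmono hv.1
    have hKv2 : K v < K vb := hKmono hv.2
    have hmem : 2 * K v + sbar ∈ uIcc (r (0, xa)) (r (0, xb)) := by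
      rw [uIcc_of_le hab.le]
      constructor <;> linarith
    have hsubI : uIcc xa xb ⊆ Icc x₁ (x₁ + δ / 2) := uIcc_subset_Icc hxa hxb
    obtain ⟨x, hx, hxv⟩ := intermediate_value_uIcc (hρc.continuousOn) hmem
    obtain ⟨v', hKv', hκv'⟩ := hC x (hball x (hIcc_ball x (hsubI hx)))
    have hvv : v' = v := hKmono.injective (by rw [hKv']; simp only at hxv; linarith)
    exact hv' (hvv ▸ hκv')
  -- (5) `r` is constant on `ℝ × ℝ`, so the solution is forward-flat
  have hρconst : ∀ x, r (0, x) = r (0, 0) := fun x =>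
    is_const_of_deriv_eq_zero (f := fun y : ℝ => r (0, y)) (fun y => (hρd y).differentiableAt)
      (fun y => by rw [(hρd y).deriv, hD y]) x 0
  have hrconst : ∀ q : ℝ × ℝ, r q = r (0, 0) := by
    rintro ⟨z, x⟩
    obtain ⟨X, hX0, hX⟩ := hfwd z x
    have h := const_along (c := c₁) hr1 hPDE1 hX z 0
    rw [hX0] at h
    rw [h, hρconst]
  have hflat : ∀ q, fderiv ℝ p q (0, 1) + κ (w q) * fderiv ℝ w q (0, 1) = 0 := by
    intro q
    rw [← hrD, show r = fun _ => r (0, 0) from funext hrconst]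
    simp
  exact pSystem_const_of_forward_flat hw1 hp1 hκd hsys1 hsys2 hκpos hκhi hk₁ hW₁ hgn hflat

/-- **Forward-quiet twin**: if instead the FORWARD invariant `r = p + K(w)` has one two-sided limit `rbar` at spatial infinity on the
slice `z = 0` (and `s` is arbitrary), the solution is constant — by the reflection `x ↦ −x`, `p ↦ −p`, which maps solutions to
solutions and exchanges the two Riemann invariants (`s̃(0, x) = −r(0, −x)`). [folklore] -/
theorem pSystem_const_of_quiet_forward_invariant {rbar : ℝ} (hw : ContDiff ℝ 2 w) (hp : ContDiff ℝ 2 p)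
    (hK2 : ContDiff ℝ 2 K) (hKd : ∀ v, HasDerivAt K (κ v) v) (hκd : ∀ v, HasDerivAt κ (κ' v) v) (hκ'c : Continuous κ')
    (hsys1 : ∀ q, fderiv ℝ p q (1, 0) = -(κ (w q) ^ 2 * fderiv ℝ w q (0, 1)))
    (hsys2 : ∀ q, fderiv ℝ w q (1, 0) = -fderiv ℝ p q (0, 1))
    (hκlo0 : 0 < κlo) (hκlo : ∀ q, κlo ≤ κ (w q)) (hκhi : ∀ q, κ (w q) ≤ κhi)
    (hκpos : ∀ v, 0 < κ v) (hgn : ∀ a b : ℝ, a < b → ∃ v ∈ Ioo a b, κ' v ≠ 0)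
    (hk₁ : ∀ q, |κ' (w q)| ≤ k₁) (hW₁ : ∀ q, |fderiv ℝ w q (0, 1)| ≤ W₁) (hMw : ∀ q, |w q| ≤ Mw)
    (hquietTop : Tendsto (fun x : ℝ => p (0, x) + K (w (0, x))) atTop (𝓝 rbar))
    (hquietBot : Tendsto (fun x : ℝ => p (0, x) + K (w (0, x))) atBot (𝓝 rbar)) :
    ∀ q q' : ℝ × ℝ, w q = w q' ∧ p q = p q' := by
  have hw1 : Differentiable ℝ w := hw.differentiable (by simp)
  have hp1 : Differentiable ℝ p := hp.differentiable (by simp)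
  -- the reflection `R (z, x) = (z, -x)` (template: `…PSystemNonuniformConst.backward_gradient_eq_zero`)
  set R : ℝ × ℝ → ℝ × ℝ := fun q => (q.1, -q.2) with hR
  set R' : ℝ × ℝ →L[ℝ] ℝ × ℝ := (ContinuousLinearMap.fst ℝ ℝ ℝ).prod (-(ContinuousLinearMap.snd ℝ ℝ ℝ)) with hR'
  have hRd : ∀ q, HasFDerivAt R R' q := fun q => hasFDerivAt_fst.prodMk hasFDerivAt_snd.neg
  have hRc : ContDiff ℝ 2 R := contDiff_fst.prodMk contDiff_snd.neg
  have hR10 : R' (1, 0) = (1, 0) := by simp [hR']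
  have hR01 : R' (0, 1) = -(0, 1) := by simp [hR']
  set w' : ℝ × ℝ → ℝ := fun q => w (R q) with hw'
  set p' : ℝ × ℝ → ℝ := fun q => -p (R q) with hp'
  have hw'2 : ContDiff ℝ 2 w' := hw.comp hRc
  have hp'2 : ContDiff ℝ 2 p' := (hp.comp hRc).neg
  have hw'D : ∀ q v, fderiv ℝ w' q v = fderiv ℝ w (R q) (R' v) := by
    intro q v
    have h := ((hw1 (R q)).hasFDerivAt.comp q (hRd q)).fderiv
    rw [show w' = w ∘ R from rfl, h]
    simp
  have hp'D : ∀ q v, fderiv ℝ p' q v = -fderiv ℝ p (R q) (R' v) := by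
    intro q v
    have h := ((hp1 (R q)).hasFDerivAt.comp q (hRd q)).neg.fderiv
    rw [show p' = -(p ∘ R) from rfl, h]
    simp
  have hsys1' : ∀ q, fderiv ℝ p' q (1, 0) = -(κ (w' q) ^ 2 * fderiv ℝ w' q (0, 1)) := by
    intro q; rw [hp'D, hw'D, hR10, hR01, map_neg, hsys1]; ring
  have hsys2' : ∀ q, fderiv ℝ w' q (1, 0) = -fderiv ℝ p' q (0, 1) := by
    intro q; rw [hw'D, hp'D, hR10, hR01, map_neg, hsys2]; ring
  have hW₁' : ∀ q, |fderiv ℝ w' q (0, 1)| ≤ W₁ := fun q => by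
    rw [hw'D, hR01, map_neg, abs_neg]; exact hW₁ (R q)
  -- the backward invariant of the reflected solution on the slice is `x ↦ −r(0, −x)`
  have hqTop : Tendsto (fun x : ℝ => p' (0, x) - K (w' (0, x))) atTop (𝓝 (-rbar)) := by
    refine ((hquietBot.comp tendsto_neg_atTop_atBot).neg).congr fun x => ?_
    show -(p (0, -x) + K (w (0, -x))) = -p (0, -x) - K (w (0, -x))
    ring
  have hqBot : Tendsto (fun x : ℝ => p' (0, x) - K (w' (0, x))) atBot (𝓝 (-rbar)) := by
    refine ((hquietTop.comp tendsto_neg_atBot_atTop).neg).congr fun x => ?_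
    show -(p (0, -x) + K (w (0, -x))) = -p (0, -x) - K (w (0, -x))
    ring
  have h := pSystem_const_of_quiet_backward_invariant hw'2 hp'2 hK2 hKd hκd hκ'c hsys1' hsys2' hκlo0
    (fun q => hκlo (R q)) (fun q => hκhi (R q)) hκpos hgn (fun q => hk₁ (R q)) hW₁' (fun q => hMw (R q)) hqTop hqBot
  intro q q'
  obtain ⟨h1, h2⟩ := h (R q) (R q')
  have hRR : ∀ q, R (R q) = q := fun q => by simp [hR]
  simp only [hw', hp', hRR] at h1 h2
  exact ⟨h1, by linarith⟩

end Summit.NavierStokesRegularity.NavierStokesRegularity.Theorems.PoloidalWindowDoorPoloidalWindowRigidityZShockQuietInvariant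

end
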